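import Mathlib
import Summits.Ventures.PercRepro2.Defs
import Summits.Ventures.PercRepro2.Independence
import Summits.Ventures.PercRepro2.Harris
import Summits.Ventures.PercRepro2.Graph
import Summits.Ventures.PercRepro2.Exploration
import Summits.Ventures.PercRepro2.Events
import Summits.Ventures.PercRepro2.FourFunctions
import Summits.Ventures.PercRepro2.Induced
import Summits.Ventures.PercRepro2.Frontier
import Summits.Ventures.PercRepro2.ObsIndependence
import Summits.Ventures.PercRepro2.BHK
import Summits.Ventures.PercRepro2.BHKEvents
import Summits.Ventures.PercRepro2.OrderPreservation
import Summits.Ventures.PercRepro2.OrderPreservationDual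
import Summits.Ventures.PercRepro2.R2PrimeThreeReduction
import Summits.Ventures.PercRepro2.YBridge

/-!
# (Yu1), part 2: event identities (blind cell PercRepro2, typer-1)

With `R = {a₂ ∉ C₁, a₃ ∉ C₁} = avoidAll ends a₁ {a₂, a₃}` and the cluster events of
`prob_clusterIn_inter_avoid_eq_expect` (`C₁ ∈ 𝓤`, `C₂ ∈ 𝓥`, `R`):

* `Nh_event_eq`, `PD_event_eq`, `PDo_event_eq`, `Tlh_event_eq`, `rb_event_eq` rewrite
  `P(b ∈ C₂, R)`, `P(PD)`, `P(PD, o ∈ C₁)`, `T_{l→h} = P(PD, o ∈ C₁, b ∈ C₂)` and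
  `r_b = P(b ∈ C₁, T)` as such cluster events;
* `Nh_eq`: `N_h = M₂ + P(b ∈ C₂, T)` (split `R` along `a₃ ∈ C₂`);
* `order_on_R`: `P(b ∈ C₁, R) ≤ P(b ∈ C₂, R)` under the labelling `P(b ↔ a₁) ≤ P(b ↔ a₂)`
  (R10d `orderPreserving_conn_down` with the down-set `R`) — step (4) of (Yu1).
-/

namespace Summit.Ventures.PercRepro2

open UnionCluster

section Yu1Events

variable {V : Type*} {E : Type*} [Fintype E] [DecidableEq E] [Fintype V] [DecidableEq V]
  {R : Type*} [Field R] [LinearOrder R] [IsStrictOrderedRing R]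

omit [Fintype E] [DecidableEq E] [Fintype V] in
/-- `{b ∈ C₂} ∩ R` is `{C₁ ∈ univ, C₂ ∈ {b ∈ ·}, R}`. -/
lemma Nh_event_eq (ends : E → Sym2 V) (a₁ a₂ a₃ b : V) :
    clusterInEvent ends a₁ Set.univ ∩ clusterInEvent ends a₂ {W | b ∈ W} ∩ avoidAll ends a₁ {a₂, a₃} =
      connEvent ends a₂ b ∩ avoidAll ends a₁ {a₂, a₃} := by
  ext ω
  simp [clusterInEvent]

omit [Fintype E] [DecidableEq E] [Fintype V] in
/-- `P(PD)` as `{C₁ ∈ univ, C₂ ∈ {a₃ ∉ ·}, R}`. -/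
lemma PD_event_eq (ends : E → Sym2 V) (a₁ a₂ a₃ : V) :
    clusterInEvent ends a₁ Set.univ ∩ clusterInEvent ends a₂ {W | a₃ ∉ W} ∩
        avoidAll ends a₁ {a₂, a₃} = PDEvent ends a₁ a₂ a₃ := by
  ext ω
  simp only [PDEvent, Dtilde, inU, clusterInEvent, Set.mem_inter_iff, Set.mem_setOf_eq,
    Set.mem_univ, true_and, mem_cluster, avoidAll, Finset.mem_insert, Finset.mem_singleton,
    Set.mem_compl_iff, Set.mem_union, mem_connEvent]
  constructor
  · rintro ⟨h2, h⟩
    exact ⟨h _ (Or.inl rfl), fun h' => h'.elim (fun h' => h _ (Or.inr rfl) (conn_symm h'))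
      (fun h' => h2 (conn_symm h'))⟩
  · rintro ⟨h12, h3⟩
    refine ⟨fun h' => h3 (Or.inr (conn_symm h')), ?_⟩
    intro x hx
    rcases hx with rfl | rfl
    · exact h12
    · exact fun h' => h3 (Or.inl (conn_symm h'))

omit [Fintype E] [DecidableEq E] [Fintype V] in
/-- `P(PD, o ∈ C₁)` as `{C₁ ∈ {o ∈ ·}, C₂ ∈ {a₃ ∉ ·}, R}`. -/
lemma PDo_event_eq (ends : E → Sym2 V) (o a₁ a₂ a₃ : V) :
    clusterInEvent ends a₁ {W | o ∈ W} ∩ clusterInEvent ends a₂ {W | a₃ ∉ W} ∩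
        avoidAll ends a₁ {a₂, a₃} = PDEvent ends a₁ a₂ a₃ ∩ connEvent ends a₁ o := by
  have h := PD_event_eq ends a₁ a₂ a₃
  ext ω
  have key := Set.ext_iff.1 h ω
  simp only [clusterInEvent, Set.mem_inter_iff, Set.mem_setOf_eq, Set.mem_univ, true_and,
    mem_cluster, mem_connEvent] at key ⊢
  tauto

omit [Fintype E] [DecidableEq E] [Fintype V] in
/-- `T_{l→h} = P(PD, o ∈ C₁, b ∈ C₂)` as `{C₁ ∈ {o ∈ ·}, C₂ ∈ {b ∈ ·} ∩ {a₃ ∉ ·}, R}`. -/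
lemma Tlh_event_eq (ends : E → Sym2 V) (o a₁ a₂ a₃ b : V) :
    clusterInEvent ends a₁ {W | o ∈ W} ∩ clusterInEvent ends a₂ ({W | b ∈ W} ∩ {W | a₃ ∉ W}) ∩
        avoidAll ends a₁ {a₂, a₃} =
      PDEvent ends a₁ a₂ a₃ ∩ connEvent ends a₁ o ∩ connEvent ends a₂ b := by
  have h := PD_event_eq ends a₁ a₂ a₃
  ext ω
  have key := Set.ext_iff.1 h ω
  simp only [clusterInEvent, Set.mem_inter_iff, Set.mem_setOf_eq, Set.mem_univ, true_and,
    mem_cluster, mem_connEvent] at key ⊢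
  tauto

omit [Fintype E] [DecidableEq E] [Fintype V] in
/-- `r_b = P(b ∈ C₁, T)` as `{C₁ ∈ {b ∈ ·}, C₂ ∈ {a₃ ∈ ·}, R}`. -/
lemma rb_event_eq (ends : E → Sym2 V) (a₁ a₂ a₃ b : V) :
    clusterInEvent ends a₁ {W | b ∈ W} ∩ clusterInEvent ends a₂ {W | a₃ ∈ W} ∩
        avoidAll ends a₁ {a₂, a₃} = connEvent ends a₁ b ∩ TEvent ends a₁ a₂ a₃ := by
  ext ω
  simp only [clusterInEvent, TEvent, Set.mem_inter_iff, Set.mem_setOf_eq, mem_cluster,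
    mem_connEvent, avoidAll, Finset.mem_insert, Finset.mem_singleton, Set.mem_compl_iff]
  constructor
  · rintro ⟨⟨hb, h3⟩, hR⟩
    exact ⟨hb, fun h' => hR _ (Or.inl rfl) (conn_symm h'), h3⟩
  · rintro ⟨hb, h21, h23⟩
    refine ⟨⟨hb, h23⟩, ?_⟩
    intro x hx
    rcases hx with rfl | rfl
    · exact fun h' => h21 (conn_symm h')
    · exact fun h' => h21 (conn_trans h23 (conn_symm h'))

omit [Fintype V] [LinearOrder R] [IsStrictOrderedRing R] in
/-- `N_h = M₂ + P(b ∈ C₂, T)`: split `R` along `a₃ ∈ C₂`. -/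
lemma Nh_eq (p : E → R) (ends : E → Sym2 V) (a₁ a₂ a₃ b : V) :
    prob p (connEvent ends a₂ b ∩ avoidAll ends a₁ {a₂, a₃}) =
      massM2 p ends a₁ a₂ a₃ b + prob p (connEvent ends a₂ b ∩ TEvent ends a₁ a₂ a₃) := by
  have h := prob_inter_add_prob_inter_compl p (connEvent ends a₂ b ∩ avoidAll ends a₁ {a₂, a₃})
    (connEvent ends a₂ a₃)
  have e1 : connEvent ends a₂ b ∩ avoidAll ends a₁ {a₂, a₃} ∩ connEvent ends a₂ a₃ =
      connEvent ends a₂ b ∩ TEvent ends a₁ a₂ a₃ := by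
    ext ω
    simp only [Set.mem_inter_iff, mem_connEvent, avoidAll, Finset.mem_insert, Finset.mem_singleton,
      TEvent, Set.mem_setOf_eq, Set.mem_compl_iff]
    constructor
    · rintro ⟨⟨hb, hR⟩, h23⟩
      exact ⟨hb, fun h' => hR _ (Or.inl rfl) (conn_symm h'), h23⟩
    · rintro ⟨hb, h21, h23⟩
      refine ⟨⟨hb, ?_⟩, h23⟩
      intro x hx
      rcases hx with rfl | rfl
      · exact fun h' => h21 (conn_symm h')
      · exact fun h' => h21 (conn_trans h23 (conn_symm h'))
  have e2 : connEvent ends a₂ b ∩ avoidAll ends a₁ {a₂, a₃} ∩ (connEvent ends a₂ a₃)ᶜ =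
      PDEvent ends a₁ a₂ a₃ ∩ connEvent ends a₂ b := by
    ext ω
    simp only [Set.mem_inter_iff, mem_connEvent, avoidAll, Finset.mem_insert, Finset.mem_singleton,
      PDEvent, Dtilde, inU, Set.mem_compl_iff, Set.mem_union]
    constructor
    · rintro ⟨⟨hb, hR⟩, h23⟩
      exact ⟨⟨hR _ (Or.inl rfl), fun h' => h'.elim (fun h' => hR _ (Or.inr rfl) (conn_symm h'))
        (fun h' => h23 (conn_symm h'))⟩, hb⟩
    · rintro ⟨⟨h12, h3⟩, hb⟩
      refine ⟨⟨hb, ?_⟩, fun h' => h3 (Or.inr (conn_symm h'))⟩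
      intro x hx
      rcases hx with rfl | rfl
      · exact h12
      · exact fun h' => h3 (Or.inl (conn_symm h'))
  rw [e1, e2] at h
  unfold massM2
  rw [← h, add_comm]

/-- `P(b ∈ C₁, R) ≤ P(b ∈ C₂, R)` under the labelling (R10d with the down-set `R`). -/
lemma order_on_R (p : E → R) (hp : IsProbVec p) (ends : E → Sym2 V) {a₁ a₂ a₃ b : V}
    (hord : prob p (connEvent ends a₁ b) ≤ prob p (connEvent ends a₂ b)) :
    prob p (connEvent ends a₁ b ∩ avoidAll ends a₁ {a₂, a₃}) ≤
      prob p (connEvent ends a₂ b ∩ avoidAll ends a₁ {a₂, a₃}) := by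
  have hD : IsLowerSet {W : Set V | a₂ ∉ W ∧ a₃ ∉ W} :=
    fun _ _ h ⟨h2, h3⟩ => ⟨fun h' => h2 (h h'), fun h' => h3 (h h')⟩
  have key := orderPreserving_conn_down p hp ends a₂ a₁ b hD hord
  have e : clusterInEvent ends a₁ {W : Set V | a₂ ∉ W ∧ a₃ ∉ W} = avoidAll ends a₁ {a₂, a₃} := by
    ext ω
    simp only [clusterInEvent, Set.mem_setOf_eq, mem_cluster, avoidAll, Finset.mem_insert,
      Finset.mem_singleton]
    constructor
    · rintro ⟨h2, h3⟩ x hx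
      rcases hx with rfl | rfl
      · exact h2
      · exact h3
    · intro h
      exact ⟨h _ (Or.inl rfl), h _ (Or.inr rfl)⟩
  rwa [e] at key

end Yu1Events

end Summit.Ventures.PercRepro2
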